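import Mathlib
import HarnessLib
import Literature.Analysis.FluidPDE.VorticityCalculus
import Summits.NavierStokesRegularity.NavierStokesRegularity.Theorems.PoloidalWindowDoorPoloidalWindowRigidityLeafUniformOrbits

/-!
# Route `PoloidalWindowDoor`, crux `PoloidalWindowRigidity` (K2, stmt-NavierStokesRegularity-19708) — LINE 21 «hot_hull» (ns-idea-8): SLIDING along a leaf —
# generic lemmas (helper S4 of H6 `LeafRecurrence`)

Cell ns-regularity-ideate, seat ns-poloidal-K2-p2 g14 (K2 stub-worker hand, H6 under DIRECTOR-NS #288).  Mathlib-level facts used by the sliding flow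
`Φ_σ U := U(·, · + γ_U σ)` of H6:

* `tendstoLocallyUniformly_comp_add` — if `F k → f` locally uniformly on a proper normed group, `f` is continuous and `a k → a₀`, then
  `x ↦ F k (x + a k)` → `x ↦ f (x + a₀)` locally uniformly (uniform continuity of `f` on a compact thickening).  This makes the sliding hull of an
  escaping end INVARIANT under sliding (translating the translates by the re-based leaf points) and is the continuity of `Φ_σ` in the profile.
* `leaf_unique` — two global integral curves of a Lipschitz field with the same initial point coincide (tree `…LeafUniformOrbits.shift_eq_of_eq`);
  `rebased_leaf_zero` / `hasDerivAt_rebased_leaf` — `σ' ↦ γ(σ + σ') − γ σ` is the integral curve through `0` of the TRANSLATED field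
  `x ↦ X (x + γ σ)`; hence the leaf of `Φ_σ U` is the re-based leaf and `Φ_{σ'} (Φ_σ U) = Φ_{σ + σ'} U` (`slide_slide`); `curl_slide` is the
  translated-vorticity identity `ω_{U(·,·+c)} = ω_U(· + c)`.

WHAT THIS IS NOT: not a claim about Navier–Stokes regularity — ODE/topology bookkeeping for a support of a PASSed research decomposition of ⟨19708⟩'s
residues (bears_on LADDER-NS N0, rung N0-LocalTubeDoorPoloidal); research cells OPEN; crux 19708 / item 20428 OPEN; NS regularity NOT proved.
-/

noncomputable section

-- the summit and its single sub-problem share the name (CONVENTIONS §1), as in every Theorems file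
set_option linter.dupNamespace false

namespace Summit.NavierStokesRegularity.NavierStokesRegularity.Theorems.PoloidalWindowDoorPoloidalWindowRigidityHotHullSliding

open Set Function Filter Topology Metric
open scoped NNReal
open Summit.NavierStokesRegularity.NavierStokesRegularity.Theorems.PoloidalWindowDoorPoloidalWindowRigidityLeafUniformOrbits

section Generic

variable {E : Type*} [NormedAddCommGroup E] [NormedSpace ℝ E]

omit [NormedSpace ℝ E] in
/-- **Locally uniform convergence is stable under convergent re-centring.** [folklore] -/
theorem tendstoLocallyUniformly_comp_add [ProperSpace E] {β : Type*} [PseudoMetricSpace β] {ι : Type*} {p : Filter ι}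
    {F : ι → E → β} {f : E → β} (hF : TendstoLocallyUniformly F f p) (hf : Continuous f)
    {a : ι → E} {a₀ : E} (ha : Tendsto a p (𝓝 a₀)) :
    TendstoLocallyUniformly (fun k x => F k (x + a k)) (fun x => f (x + a₀)) p := by
  rw [tendstoLocallyUniformly_iff_forall_isCompact]
  intro K hK
  rw [Metric.tendstoUniformlyOn_iff]
  intro ε hε
  set K' : Set E := (fun q : E × E => q.1 + q.2) '' (K ×ˢ closedBall a₀ 1) with hK'def
  have hK' : IsCompact K' := (hK.prod (isCompact_closedBall a₀ 1)).image (continuous_fst.add continuous_snd)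
  obtain ⟨δ, hδ, hδf⟩ := Metric.uniformContinuousOn_iff.1 (hK'.uniformContinuousOn_of_continuous hf.continuousOn) (ε / 2) (half_pos hε)
  have hFu : ∀ᶠ k in p, ∀ y ∈ K', dist (f y) (F k y) < ε / 2 :=
    Metric.tendstoUniformlyOn_iff.1 ((tendstoLocallyUniformly_iff_forall_isCompact.1 hF) K' hK') (ε / 2) (half_pos hε)
  have ha' : ∀ᶠ k in p, dist (a k) a₀ < min δ 1 := Metric.tendsto_nhds.1 ha _ (lt_min hδ one_pos)
  filter_upwards [hFu, ha'] with k hk hak x hx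
  have h1 : x + a₀ ∈ K' := ⟨(x, a₀), ⟨hx, mem_closedBall_self zero_le_one⟩, rfl⟩
  have h2 : x + a k ∈ K' := ⟨(x, a k), ⟨hx, mem_closedBall.2 (lt_min_iff.1 hak).2.le⟩, rfl⟩
  have hd : dist (x + a₀) (x + a k) < δ := by
    rw [dist_add_left, dist_comm]
    exact (lt_min_iff.1 hak).1
  calc dist (f (x + a₀)) (F k (x + a k)) ≤ dist (f (x + a₀)) (f (x + a k)) + dist (f (x + a k)) (F k (x + a k)) := dist_triangle _ _ _
    _ < ε / 2 + ε / 2 := add_lt_add (hδf _ h1 _ h2 hd) (hk _ h2)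
    _ = ε := add_halves ε

variable {X : E → E} {K : ℝ≥0}

/-- **Global integral curves of a Lipschitz field are determined by their initial point.** [folklore] -/
theorem leaf_unique (hX : LipschitzWith K X) {γ₁ γ₂ : ℝ → E} (h₁ : ∀ τ, HasDerivAt γ₁ (X (γ₁ τ)) τ)
    (h₂ : ∀ τ, HasDerivAt γ₂ (X (γ₂ τ)) τ) (h0 : γ₁ 0 = γ₂ 0) : γ₁ = γ₂ :=
  funext fun σ => by simpa using shift_eq_of_eq hX h₁ h₂ (a := 0) (b := 0) h0 σ

omit [NormedSpace ℝ E] in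
/-- The re-based curve `σ' ↦ γ(σ + σ') − γ σ` starts at `0`. -/
theorem rebased_leaf_zero (γ : ℝ → E) (σ : ℝ) : (fun σ' => γ (σ + σ') - γ σ) 0 = 0 := by
  simp

/-- **The re-based curve is the integral curve of the translated field** `x ↦ X (x + γ σ)` through `0`. [folklore] -/
theorem hasDerivAt_rebased_leaf {γ : ℝ → E} (hγ : ∀ τ, HasDerivAt γ (X (γ τ)) τ) (σ σ' : ℝ) :
    HasDerivAt (fun σ' => γ (σ + σ') - γ σ) ((fun x => X (x + γ σ)) (γ (σ + σ') - γ σ)) σ' := by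
  have h := ((hγ (σ + σ')).comp_const_add σ σ').sub_const (γ σ)
  have e : (fun x => X (x + γ σ)) (γ (σ + σ') - γ σ) = X (γ (σ + σ')) := by
    simp only [sub_add_cancel]
  rw [e]
  exact h

omit [NormedSpace ℝ E] in
/-- Re-basing the re-based curve: `(γ(σ + ·) − γ σ)` re-based at `σ'` is `γ` re-based at `σ + σ'`. -/
theorem rebased_rebased (γ : ℝ → E) (σ σ' : ℝ) :
    (fun σ'' => (fun s => γ (σ + s) - γ σ) (σ' + σ'') - (fun s => γ (σ + s) - γ σ) σ') = fun σ'' => γ (σ + σ' + σ'') - γ (σ + σ') := by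
  funext σ''
  simp only [add_assoc]
  abel

end Generic

/-! ## Sliding a space-time profile along a vector -/

/-- Sliding twice is sliding by the sum. -/
theorem slide_slide (U : ℝ → EuclideanSpace ℝ (Fin 3) → EuclideanSpace ℝ (Fin 3)) (c₁ c₂ : EuclideanSpace ℝ (Fin 3)) :
    (fun t x => (fun t x => U t (x + c₁)) t (x + c₂)) = fun t x => U t (x + (c₂ + c₁)) := by
  funext t x
  simp only [add_assoc]

/-- Sliding by `0` does nothing. -/
theorem slide_zero (U : ℝ → EuclideanSpace ℝ (Fin 3) → EuclideanSpace ℝ (Fin 3)) :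
    (fun t x => U t (x + (0 : EuclideanSpace ℝ (Fin 3)))) = U := by
  funext t x
  simp only [add_zero]

/-- **The vorticity of a slid profile is the slid vorticity**: `curl (U t (· + c)) = curl (U t) (· + c)`. -/
theorem curl_slide (w : EuclideanSpace ℝ (Fin 3) → EuclideanSpace ℝ (Fin 3)) (c : EuclideanSpace ℝ (Fin 3)) :
    Literature.Analysis.FluidPDE.curl (fun y => w (y + c)) = fun x => Literature.Analysis.FluidPDE.curl w (x + c) := by
  funext x
  rw [Literature.Analysis.FluidPDE.curl_eq_curlCLM, Literature.Analysis.FluidPDE.curl_eq_curlCLM, fderiv_comp_add_right]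

/-- **The leaf of a slid profile is the re-based leaf.**  If `γ` is the global integral curve of `ω_U(−1,·)` then `σ' ↦ γ(σ + σ') − γ σ` is a global
integral curve of `ω_{U(·, · + γ σ)}(−1,·)` through `0`. -/
theorem rebased_leaf_of_slide {U : ℝ → EuclideanSpace ℝ (Fin 3) → EuclideanSpace ℝ (Fin 3)} {γ : ℝ → EuclideanSpace ℝ (Fin 3)}
    (hγ : ∀ τ, HasDerivAt γ (Literature.Analysis.FluidPDE.curl (U (-1)) (γ τ)) τ) (σ : ℝ) :
    (fun σ' => γ (σ + σ') - γ σ) 0 = 0 ∧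
      ∀ σ', HasDerivAt (fun σ' => γ (σ + σ') - γ σ)
        (Literature.Analysis.FluidPDE.curl ((fun t x => U t (x + γ σ)) (-1)) (γ (σ + σ') - γ σ)) σ' := by
  refine ⟨rebased_leaf_zero γ σ, fun σ' => ?_⟩
  have e : Literature.Analysis.FluidPDE.curl ((fun t x => U t (x + γ σ)) (-1)) =
      fun x => Literature.Analysis.FluidPDE.curl (U (-1)) (x + γ σ) := curl_slide (U (-1)) (γ σ)
  rw [e]
  exact hasDerivAt_rebased_leaf hγ σ σ'

end Summit.NavierStokesRegularity.NavierStokesRegularity.Theorems.PoloidalWindowDoorPoloidalWindowRigidityHotHullSliding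

end
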